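import Summits.Langlands.Langlands.Theses.TriangulineChamber
import Summits.Langlands.Langlands.Theorems.TriangulineChamberLiftB2CrysSplitPPin

/-!
# `LiftB2CrysRamifiedP` (item stmt-Langlands-8574, crux of route `TriangulineChamber`) — the typed
# decomposition into four pieces and its assembly

The crux `LiftB2CrysRamifiedP` of route `TriangulineChamber` (summit `Langlands`) is the
(B)-direction lifting slice for `GL₂` over a totally real `F` at a prime `p ≥ 7` RAMIFIED in `F`
(`p ∣ disc F`), in the summit's `∃ RD`-shape:

  `∀ F p, 7 ≤ p → p ∣ disc F → ∃ RD : ReciprocityData F,`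
  `    PIN(RD) ∧ ∀ hcpt, (A)₂reg(RD, hcpt) ∧ (B)-slice(RD, hcpt)`.

It conjoins, under one existential, four mathematically distinct statements with four different
literatures and statuses.  This file PROVES that the crux follows from the four pieces below
(crux-strategist decomposition, BC2 redirect; the pieces become the route's leaves by
`ledger route edit --split LiftB2CrysRamifiedP`, whose children carry exactly the hypothesis texts
of `LiftB2CrysRamifiedP_of_pieces`):

* `h1` — **CyclotomicPinLocal** (local clause (F8) of Fontaine's datum): at every place `v ∣ p` of a
  number field, a rank-one representation of `Γ_{F_v}` with entry `ε_{F_v}^m` has `τ`-labelled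
  Hodge–Tate weights `{-m}` for the PINNED datum `fontainePstAdicCompletion v p hv` (whose period
  ring is the constructed `B_dR(F_v)` since 2026-08-17, `fontainePst_𝔅_eq_bdRPeriodRingData`).
  Tate 1967 §3; Fontaine 1994, Exp. III §1.5 (`D_dR(ℚ_p(m)) = F_v · t^{-m}`).  It yields the
  crux's first conjunct PIN(RD) for EVERY `RD` through the landed `pin_of_localPin`
  (`ReciprocityData.pst` ignores `RD`; `ε_F ∘ res_v = ε_{F_v}`).
* `h2` — **GalRepRegularHilbert** (direction (A) for regular `L`-algebraic cuspidal `π` of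
  `GL₂(𝔸_F)`, `F` totally real, with local–global compatibility at every finite place, packaged
  with the reciprocity datum it pins): `∀ F, ∃ RD, ∀ hcpt, (A)₂reg(RD, hcpt)`.  Carayol 1986,
  Taylor 1989, Blasius–Rogawski 1993 (existence, compatibility at `v ∤ ℓ`); Saito 2009,
  Skinner 2009, T. Liu 2012 (compatibility at `v ∣ ℓ`); Harris–Taylor 2001 Thm. A (`rec_v`).
* `h3` — **SatakeUpgradeRegularGL2** (Chebotarev + Brauer–Nesbitt upgrade): relative to any `RD`
  carrying (A)₂reg, an IRREDUCIBLE `ρ` attached at almost all places (Satake–Frobenius) to a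
  regular `L`-algebraic cuspidal `π` satisfies the full `Corresponds RD ι π ρ` — because the
  (A)-representation `ρ'` of `π` has the same Frobenius characteristic polynomials at almost all
  places, hence `ρ ≅ ρ'` (Chebotarev density, Brauer–Nesbitt), and `Corresponds` is an isomorphism
  invariant.  Serre 1968, Ch. I §2.3; Deligne–Serre 1974, Lemme 3.2 pattern.
* `h4` — **WeakLiftCrysRamifiedP** (the RD-FREE automorphy lifting theorem at a ramified prime, in
  the printed shape of `Literature.NumberTheory.Automorphic.HuTan2015_theorem63`): `F` totally
  real, `p ≥ 7`, `p ∣ disc F`; `ρ : Γ_F → GL₂(ℚ̄_p)` irreducible, almost everywhere unramified,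
  totally odd, crystalline with two distinct `τ`-labelled Hodge–Tate weights at every `v ∣ p` for
  the pinned datum, with GENERIC residual restriction at every `v ∣ p`, `ρ̄|_{Γ_{F(ζ_p)}}`
  absolutely irreducible (trace rendering), residually automorphic from a regular `L`-algebraic
  cuspidal `π₀` in the WEAK
  sense (Satake–Frobenius at almost all places) ⇒ `ρ` is attached at almost all places to some
  regular `L`-algebraic cuspidal `π`.  Known for `F_v = ℚ_p` (Kisin 2009, Hu–Tan 2015) and in
  potentially diagonalisable / potentially Barsotti–Tate regimes (Kisin, Gee, BLGGT, Gee–Kisin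
  2014); OPEN in general at a ramified `v ∣ p` — the heart of the crux, now isolated from the `∃ RD`
  bookkeeping, the (A)-direction and the cyclotomic pin.

Assembly (`LiftB2CrysRamifiedP_of_pieces`): `h2` supplies `RD` and (A)₂reg; `h1` and
`pin_of_localPin` supply PIN(RD); for a `ρ` as in the slice, `IsGeometricFramed RD ρ` gives
almost-everywhere unramifiedness, the residual seed `Corresponds RD ι π₀ ρ₀` is weakened to its
Satake–Frobenius part, the crystalline hypothesis for `RD.pst p v hv` IS the one for the pinned
datum (definitional unfolding of `ReciprocityData.pst`), `h4` produces `π`, and `h3` upgrades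
Satake–Frobenius compatibility to `Corresponds RD ι π ρ`.

Probes (crux-strategist BC2(c), files `bc/<Piece>_probe.lean` of the strategist folder): for each
piece `Xᵢ`, `Xᵢ → Langlands` and `Xᵢ → LiftB2CrysRamifiedP` by
`first | exact? | simpa | (unfold; simpa) | aesop` FAIL (recorded in the item evidence).

Helper for the item (`--supports stmt-Langlands-8574`); it does not close it.  No definition is
introduced (the pieces are hypotheses written inline; their texts are the children statements of
the split).  Axioms: `propext`, `Classical.choice`, `Quot.sound`.
-/

-- project-wide option (lakefile weak.linter.dupNamespace); `Summit.Langlands.Langlands` is mandated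
set_option linter.dupNamespace false

namespace Summit.Langlands.Langlands.Theorems.LiftB2CrysRamifiedPSplit

open Summit.Langlands.Langlands.Theses.TriangulineChamber
open scoped Matrix Classical
open Filter Set Function

/-- **`LiftB2CrysRamifiedP` from its four pieces** (crux-strategist decomposition of item
stmt-Langlands-8574; see the module docstring for the pieces).  Hypotheses, in order:
`h1` = CyclotomicPinLocal (labelled Hodge–Tate weights `{-m}` of `ε_{F_v}^m` for the pinned Fontaine
datum; Tate 1967, Fontaine 1994 Exp. III §1.5), `h2` = GalRepRegularHilbert (`∃ RD` with direction
(A) for regular `L`-algebraic cuspidal `π` on `GL₂` over totally real `F`; Carayol, Taylor,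
Blasius–Rogawski, Saito, Skinner, Liu), `h3` = SatakeUpgradeRegularGL2 (Satake–Frobenius
compatibility a.e. of an irreducible `ρ` with a regular `π` upgrades to `Corresponds` given (A)₂reg;
Chebotarev + Brauer–Nesbitt), `h4` = WeakLiftCrysRamifiedP (the RD-free lifting theorem at a prime
`p ≥ 7` ramified in `F`, Hu–Tan/Kisin shape with generic residual restriction at `v ∣ p`).
Proof: `RD` and (A)₂reg from `h2`; PIN from `h1` by `pin_of_localPin`; for each `ρ` of the slice,
almost-everywhere unramifiedness is the first half of `IsGeometricFramed RD ρ`, the seed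
`Corresponds RD ι π₀ ρ₀` is weakened to its Satake half, the crystalline clause for `RD.pst p v hv`
is the clause for `fontainePstAdicCompletion v p hv` by `rfl`, `h4` gives `π`, `h3` gives
`Corresponds RD ι π ρ`. [folklore] -/
theorem LiftB2CrysRamifiedP_of_pieces
    (h1 : ∀ (F : Type) [Field F] [NumberField F] (p : ℕ) [Fact p.Prime] (v :
      IsDedekindDomain.HeightOneSpectrum (NumberField.RingOfIntegers F)) (hv : ((p : ℕ) :
      NumberField.RingOfIntegers F) ∈ v.asIdeal) (m : ℤ) (χv :
      Literature.NumberTheory.GaloisRepresentations.FramedGaloisRep (v.adicCompletion F)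
      (PadicAlgCl p) 1), (∀ σ, (χv σ).val 0 0 = algebraMap ℚ_[p] (PadicAlgCl p)
      ((((Literature.NumberTheory.GaloisRepresentations.GaloisRep.cyclotomicCharacter
      (v.adicCompletion F) p σ : ℤ_[p]ˣ) : ℤ_[p]) : ℚ_[p]) ^ m)) →
      let D := Literature.NumberTheory.PAdicHodge.fontainePstAdicCompletion v p hv;
      letI := D.algebra; ∀ τ : v.adicCompletion F →ₐ[ℚ_[p]] PadicAlgCl p,
      D.𝔅.labelledHodgeTateWeights χv.toGaloisRep τ.toRingHom = {-m})
    (h2 : ∀ (F : Type) [Field F] [NumberField F] [NumberField.IsTotallyReal F], ∃ RD :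
      ReciprocityData F, ∀ hcpt :
      Literature.NumberTheory.Automorphic.isCompact_glFiniteIntegralLevel 2 F, ∀ π :
      Literature.NumberTheory.Automorphic.CuspidalAutomorphicRepData 2 F hcpt,
      π.1.IsLAlgebraic → (∃ T : Literature.NumberTheory.Automorphic.InfinityType F 2,
      π.1.HasInfinityType T ∧ T.IsRegular) → ∀ (ℓ : ℕ) [Fact ℓ.Prime] (ι : PadicAlgCl ℓ ≃+*
      ℂ), ∃ ρ : Literature.NumberTheory.GaloisRepresentations.FramedGaloisRep F (PadicAlgCl ℓ)
      2, ρ.toGaloisRep.IsIrreducible ∧ IsGeometricFramed RD ρ ∧ Corresponds RD ι π.1 ρ)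
    (h3 : ∀ (F : Type) [Field F] [NumberField F] (RD : ReciprocityData F) (hcpt :
      Literature.NumberTheory.Automorphic.isCompact_glFiniteIntegralLevel 2 F), (∀ π :
      Literature.NumberTheory.Automorphic.CuspidalAutomorphicRepData 2 F hcpt,
      π.1.IsLAlgebraic → (∃ T : Literature.NumberTheory.Automorphic.InfinityType F 2,
      π.1.HasInfinityType T ∧ T.IsRegular) → ∀ (ℓ : ℕ) [Fact ℓ.Prime] (ι : PadicAlgCl ℓ ≃+*
      ℂ), ∃ ρ : Literature.NumberTheory.GaloisRepresentations.FramedGaloisRep F (PadicAlgCl ℓ)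
      2, ρ.toGaloisRep.IsIrreducible ∧ IsGeometricFramed RD ρ ∧ Corresponds RD ι π.1 ρ) → ∀ (ℓ
      : ℕ) [Fact ℓ.Prime] (ι : PadicAlgCl ℓ ≃+* ℂ) (ρ :
      Literature.NumberTheory.GaloisRepresentations.FramedGaloisRep F (PadicAlgCl ℓ) 2) (π :
      Literature.NumberTheory.Automorphic.CuspidalAutomorphicRepData 2 F hcpt),
      ρ.toGaloisRep.IsIrreducible → π.1.IsLAlgebraic → (∃ T :
      Literature.NumberTheory.Automorphic.InfinityType F 2, π.1.HasInfinityType T ∧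
      T.IsRegular) → (∀ᶠ v : IsDedekindDomain.HeightOneSpectrum (NumberField.RingOfIntegers F)
      in Filter.cofinite, SatakeFrobCompatibleAt ι π.1 ρ v) → Corresponds RD ι π.1 ρ)
    (h4 : ∀ (F : Type) [Field F] [NumberField F] [NumberField.IsTotallyReal F] (p : ℕ) [Fact
      p.Prime], 7 ≤ p → ((p : ℤ) ∣ NumberField.discr F) → ∀ (hcpt :
      Literature.NumberTheory.Automorphic.isCompact_glFiniteIntegralLevel 2 F) (ι : PadicAlgCl
      p ≃+* ℂ) (ρ : Literature.NumberTheory.GaloisRepresentations.FramedGaloisRep F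
      (PadicAlgCl p) 2), ρ.toGaloisRep.IsIrreducible → (∀ᶠ v :
      IsDedekindDomain.HeightOneSpectrum (NumberField.RingOfIntegers F) in Filter.cofinite,
      ρ.IsUnramifiedAt v) → ρ.IsOdd → (∀ (v : IsDedekindDomain.HeightOneSpectrum
      (NumberField.RingOfIntegers F)) (hv : ((p : ℕ) : NumberField.RingOfIntegers F) ∈
      v.asIdeal),
      let D := Literature.NumberTheory.PAdicHodge.fontainePstAdicCompletion v p hv;
      D.IsCrystallineFramed (ρ.toLocal v) ∧ (letI := D.algebra; ∀ τ : v.adicCompletion F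
      →ₐ[ℚ_[p]] PadicAlgCl p,
      let M := ρ.labelledHodgeTateWeightsAt v D.algebra D.𝔅 τ.toRingHom; M.Nodup ∧
      Multiset.card M = 2)) → (∀ v : IsDedekindDomain.HeightOneSpectrum
      (NumberField.RingOfIntegers F), ((p : ℕ) : NumberField.RingOfIntegers F) ∈ v.asIdeal → ∀
      χ₁ χ₂ : Field.absoluteGaloisGroup (v.adicCompletion F) →* (PadicAlgCl p)ˣ, IsOpen
      (χ₁.ker : Set (Field.absoluteGaloisGroup (v.adicCompletion F))) → IsOpen (χ₂.ker : Set
      (Field.absoluteGaloisGroup (v.adicCompletion F))) → (∀ σ, ‖(ρ.toLocal v σ).val.trace -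
      ((χ₁ σ : PadicAlgCl p) + (χ₂ σ : PadicAlgCl p))‖ < 1) → (∃ σ, 1 ≤ ‖(χ₁ σ : PadicAlgCl p)
      * (χ₂ σ : PadicAlgCl p)⁻¹ - 1‖) ∧ (∃ σ, 1 ≤ ‖(χ₁ σ : PadicAlgCl p) * (χ₂ σ : PadicAlgCl
      p)⁻¹ - algebraMap ℚ_[p] (PadicAlgCl p)
      (((Literature.NumberTheory.GaloisRepresentations.GaloisRep.cyclotomicCharacter
      (v.adicCompletion F) p σ : ℤ_[p]ˣ) : ℤ_[p]) : ℚ_[p])‖)) → (¬ ∃ χ₁ χ₂ :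
      Field.absoluteGaloisGroup (CyclotomicField p F) →* (PadicAlgCl p)ˣ, IsOpen (χ₁.ker : Set
      (Field.absoluteGaloisGroup (CyclotomicField p F))) ∧ IsOpen (χ₂.ker : Set
      (Field.absoluteGaloisGroup (CyclotomicField p F))) ∧ ∀ σ, ‖(ρ.restrictField
      (CyclotomicField p F) σ).val.trace - ((χ₁ σ : PadicAlgCl p) + (χ₂ σ : PadicAlgCl p))‖ <
      1) → (∃ (π₀ : Literature.NumberTheory.Automorphic.CuspidalAutomorphicRepData 2 F hcpt)
      (ρ₀ : Literature.NumberTheory.GaloisRepresentations.FramedGaloisRep F (PadicAlgCl p) 2),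
      π₀.1.IsLAlgebraic ∧ (∃ T : Literature.NumberTheory.Automorphic.InfinityType F 2,
      π₀.1.HasInfinityType T ∧ T.IsRegular) ∧ (∀ᶠ v : IsDedekindDomain.HeightOneSpectrum
      (NumberField.RingOfIntegers F) in Filter.cofinite, SatakeFrobCompatibleAt ι π₀.1 ρ₀ v) ∧
      ∀ σ, ‖(ρ σ).val.trace - (ρ₀ σ).val.trace‖ < 1) → ∃ π :
      Literature.NumberTheory.Automorphic.CuspidalAutomorphicRepData 2 F hcpt,
      π.1.IsLAlgebraic ∧ (∃ T : Literature.NumberTheory.Automorphic.InfinityType F 2,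
      π.1.HasInfinityType T ∧ T.IsRegular) ∧ ∀ᶠ v : IsDedekindDomain.HeightOneSpectrum
      (NumberField.RingOfIntegers F) in Filter.cofinite, SatakeFrobCompatibleAt ι π.1 ρ v) :
    LiftB2CrysRamifiedP := by
  intro F _ _ _ p _ hp hdisc
  -- (A)-direction for regular L-algebraic cuspidal π on GL₂/F supplies the reciprocity datum
  obtain ⟨RD, hA⟩ := h2 F
  -- the cyclotomic-powers pin for `RD.pst` = the pinned Fontaine datum, from the local clause (F8)
  refine ⟨RD, Summit.Langlands.Langlands.Theorems.LiftB2CrysSplitP.pin_of_localPin F p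
    (fun v hv m χv hχv => h1 F p v hv m χv hχv) RD, fun hcpt => ⟨hA hcpt, ?_⟩⟩
  intro ι ρ hirr hgeom hodd hcrys hgen hbig hseed
  -- weaken the residual-automorphy seed to its almost-everywhere (Satake–Frobenius) form
  obtain ⟨π₀, ρ₀, hL₀, hreg₀, hcorr₀, hcong⟩ := hseed
  have hseed' : ∃ (π₀ : Literature.NumberTheory.Automorphic.CuspidalAutomorphicRepData 2 F hcpt)
      (ρ₀ : Literature.NumberTheory.GaloisRepresentations.FramedGaloisRep F (PadicAlgCl p) 2),
      π₀.1.IsLAlgebraic ∧ (∃ T : Literature.NumberTheory.Automorphic.InfinityType F 2,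
        π₀.1.HasInfinityType T ∧ T.IsRegular) ∧
      (∀ᶠ v : IsDedekindDomain.HeightOneSpectrum (NumberField.RingOfIntegers F) in Filter.cofinite,
        SatakeFrobCompatibleAt ι π₀.1 ρ₀ v) ∧
      ∀ σ, ‖(ρ σ).val.trace - (ρ₀ σ).val.trace‖ < 1 :=
    ⟨π₀, ρ₀, hL₀, hreg₀, hcorr₀.1, hcong⟩
  -- the RD-free lifting theorem at the ramified prime (crystalline for the pinned datum = RD.pst)
  obtain ⟨π, hL, hreg, hsat⟩ :=
    h4 F p hp hdisc hcpt ι ρ hirr hgeom.1 hodd hcrys hgen hbig hseed'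
  -- upgrade Satake–Frobenius compatibility a.e. to `Corresponds` through the (A)-direction
  exact ⟨π, hL, h3 F RD hcpt (hA hcpt) p ι ρ π hirr hL hreg hsat⟩

end Summit.Langlands.Langlands.Theorems.LiftB2CrysRamifiedPSplit
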